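import Literature.Geometry.Lorentzian.StationaryOrbitHorizontalFlow
import Literature.Geometry.Lorentzian.U1Reduction
import HarnessLib

/-!
# Anderson's form `g_M = -u² (dt + θ)² + π^* g_S` of a stationary metric, pointwise on `M`
(Anderson 2000, §0, (0.1)–(0.2))

M. T. Anderson, *On stationary vacuum solutions to the Einstein equations*, Ann. Henri Poincaré 1
(2000), §0: "The metric `g_M` on `M` may then be written in the form
`g_M = -u²(dt + θ)² + π^* g_S` (0.1), where `u² = -⟨X, X⟩ > 0` (0.2), and `θ` is a connection
1-form for the bundle `π`." This file proves the algebraic identity (0.1) at every point of `M`,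
for a stationary Killing field `X` timelike everywhere and its flow `θₛ`:

* `IsStationaryKilling.connForm` — the **connection form** `A_y(v) = ⟨X, v⟩/⟨X, X⟩` of the orbit
  bundle defined by the metric (`A(X) = 1`, `ker A = ⟨X⟩^⊥` the horizontal space):
  `connForm_apply_self`, `connForm_eq_zero_iff`, and **flow invariance** `connForm_flow`
  (`θₛ^* A = A`: the flow maps are isometries preserving `X`);
* `IsStationaryKilling.val_eq_connForm_orbitBilin` — **`g = -u² A ⊗ A + h`** with
  `h = g − λ⁻¹ X♭ ⊗ X♭` Geroch's orbit form (`PseudoRiemannianMetric.orbitBilin`, `= π^* g_S` by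
  `StationaryOrbitQuotientMetric.quotientMetricVal_mfderiv_orbitProj`) and `-u² = ⟨X, X⟩`;
* for a **time function** `t` (`t(θₛ y) = t(y) + s`, `StationaryOrbitTimeFunction.lean`):
  `mvfderiv_timeFunction_apply_self` — **`dt(X) = 1`**; `mvfderiv_timeFunction_flow` —
  `θₛ^* dt = dt`; the 1-form **`ϑ := A − dt`** (`IsStationaryKilling.thetaForm`) satisfies
  `ϑ(X) = 0` (`thetaForm_apply_self`) and `θₛ^* ϑ = ϑ` (`thetaForm_flow`) — it is horizontal and
  invariant, i.e. the pull-back of a 1-form on `S` (Anderson's `θ`); and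
* `IsStationaryKilling.val_eq_anderson` — **(0.1)**:
  `g(v, w) = -u² (dt(v) + ϑ(v)) (dt(w) + ϑ(w)) + h(v, w)`.

Everything is proved; the two definitions are explicit formulas; no named facts.

## References

* M. T. Anderson, Ann. Henri Poincaré 1 (2000) 977–994, arXiv:gr-qc/0001091, §0, (0.1)–(0.2)
  (key `Anderson2000`).
* R. Geroch, J. Math. Phys. 12 (1971) 918–924, App. A (key `Geroch1971`).
-/

noncomputable section

open Bundle Set Filter Function Manifold TopologicalSpace
open scoped ContDiff Topology Manifold

namespace Literature.Geometry.Lorentzian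

namespace LorentzianMetric

section Decomposition

variable {E : Type*} [NormedAddCommGroup E] [NormedSpace ℝ E] [FiniteDimensional ℝ E]
  [CompleteSpace E] {M : Type*} [TopologicalSpace M] [ChartedSpace E M]
  [IsManifold 𝓘(ℝ, E) ∞ M]
  {g : LorentzianMetric 𝓘(ℝ, E) ∞ M} [g.HasLeviCivita] {τ : TimeOrientation g}
  {X : Π x : M, TangentSpace 𝓘(ℝ, E) x} {θ : ℝ × M → M}

/-! ### The connection form of the orbit bundle -/

/-- **The connection form** of the orbit bundle of a stationary space-time, defined by the
metric: `A_y(v) = ⟨X, v⟩ / ⟨X, X⟩`, so that `A(X) = 1` and `ker A` is the horizontal space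
`⟨X⟩^⊥` (Anderson 2000, §0: "`θ` is a connection 1-form for the bundle `π`"; here `A = dt + θ`).
[cite: Anderson2000, §0, (0.1)] -/
def IsStationaryKilling.connForm (_h : g.IsStationaryKilling τ X univ) (y : M) :
    TangentSpace 𝓘(ℝ, E) y →L[ℝ] ℝ :=
  (g.val y (X y) (X y))⁻¹ • g.val y (X y)

omit [FiniteDimensional ℝ E] [CompleteSpace E] in
/-- `A_y(v) = ⟨X, v⟩ / ⟨X, X⟩`. [folklore] -/
theorem IsStationaryKilling.connForm_apply (h : g.IsStationaryKilling τ X univ) (y : M)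
    (v : TangentSpace 𝓘(ℝ, E) y) :
    h.connForm y v = (g.val y (X y) (X y))⁻¹ * g.val y (X y) v := rfl

omit [FiniteDimensional ℝ E] [CompleteSpace E] in
/-- **`A(X) = 1`.** [cite: Anderson2000, §0, (0.1)] -/
theorem IsStationaryKilling.connForm_apply_self (h : g.IsStationaryKilling τ X univ) (y : M) :
    h.connForm y (X y) = 1 := by
  rw [h.connForm_apply]
  exact inv_mul_cancel₀ (h.isTimelike (mem_univ y)).1.ne

omit [FiniteDimensional ℝ E] [CompleteSpace E] in
/-- **`ker A` is the horizontal space**: `A(v) = 0 ↔ ⟨v, X⟩ = 0`. [cite: Anderson2000, §1.1] -/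
theorem IsStationaryKilling.connForm_eq_zero_iff (h : g.IsStationaryKilling τ X univ) (y : M)
    (v : TangentSpace 𝓘(ℝ, E) y) : h.connForm y v = 0 ↔ g.val y v (X y) = 0 := by
  rw [h.connForm_apply, mul_eq_zero, g.symm y (X y) v]
  have hne : (g.val y (X y) (X y))⁻¹ ≠ 0 := inv_ne_zero (h.isTimelike (mem_univ y)).1.ne
  simp [hne]

omit [FiniteDimensional ℝ E] [CompleteSpace E] in
/-- The horizontal part `v − A(v) X` of a vector is horizontal. [folklore] -/
theorem IsStationaryKilling.val_sub_connForm_smul (h : g.IsStationaryKilling τ X univ) (y : M)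
    (v : TangentSpace 𝓘(ℝ, E) y) : g.val y (v - h.connForm y v • X y) (X y) = 0 := by
  have hne : g.val y (X y) (X y) ≠ 0 := (h.isTimelike (mem_univ y)).1.ne
  rw [map_sub, map_smul, sub_apply, smul_apply, smul_eq_mul, h.connForm_apply,
    g.symm y v (X y)]
  field_simp
  ring

omit [FiniteDimensional ℝ E] [CompleteSpace E] in
/-- **`g = -u² A ⊗ A + h`** (Anderson 2000, (0.1) with `A = dt + θ`): at every point,
`g(v, w) = ⟨X, X⟩ A(v) A(w) + h(v, w)` where `⟨X, X⟩ = -u²` and `h = g − λ⁻¹ X♭ ⊗ X♭` is Geroch's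
orbit form (`orbitBilin`, the pull-back `π^* g_S` of the quotient metric). [cite: Anderson2000, §0, (0.1)–(0.2)] -/
theorem IsStationaryKilling.val_eq_connForm_orbitBilin (h : g.IsStationaryKilling τ X univ)
    (y : M) (v w : TangentSpace 𝓘(ℝ, E) y) :
    g.val y v w = g.val y (X y) (X y) * h.connForm y v * h.connForm y w +
      g.toPseudoRiemannianMetric.orbitBilin X y v w := by
  have hne : g.val y (X y) (X y) ≠ 0 := (h.isTimelike (mem_univ y)).1.ne
  rw [PseudoRiemannianMetric.orbitBilin_apply, PseudoRiemannianMetric.sqNorm_apply,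
    h.connForm_apply, h.connForm_apply]
  change g.val y v w = g.val y (X y) (X y) * ((g.val y (X y) (X y))⁻¹ * g.val y (X y) v) *
      ((g.val y (X y) (X y))⁻¹ * g.val y (X y) w) +
    (g.val y v w - (g.val y (X y) (X y))⁻¹ * g.val y (X y) v * g.val y (X y) w)
  field_simp
  ring

/-- **The connection form is flow invariant**: `A_{θₛ y}(dθₛ v) = A_y(v)` (the flow maps are
isometries, `IsKillingField.val_mfderiv_flow`, and preserve `X`, `mfderiv_flow_apply_self`).
[cite: Anderson2000, §0, (0.1)] -/
theorem IsStationaryKilling.connForm_flow (h : g.IsStationaryKilling τ X univ)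
    (hθ : ContMDiff (𝓘(ℝ, ℝ).prod 𝓘(ℝ, E)) 𝓘(ℝ, E) 2 θ) (hθ0 : ∀ p, θ (0, p) = p)
    (hθadd : ∀ t s p, θ (t, θ (s, p)) = θ (t + s, p))
    (hθX : ∀ p, IsMIntegralCurve (fun t ↦ θ (t, p)) X) (s : ℝ) (y : M)
    (v : TangentSpace 𝓘(ℝ, E) y) :
    h.connForm (θ (s, y)) (mfderiv 𝓘(ℝ, E) 𝓘(ℝ, E) (fun q ↦ θ (s, q)) y v) = h.connForm y v := by
  rw [h.connForm_apply, h.connForm_apply, ← mfderiv_flow_apply_self hθ hθ0 hθadd hθX s y,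
    h.isKillingField.val_mfderiv_flow hθ hθ0 hθX s y (X y) (X y),
    h.isKillingField.val_mfderiv_flow hθ hθ0 hθX s y (X y) v]

/-! ### Time functions: `dt(X) = 1`, the form `ϑ = A − dt` -/

variable {t : M → ℝ}

omit [FiniteDimensional ℝ E] [CompleteSpace E] in
/-- **`dt(X) = 1` for a time function** (`t(θₛ y) = t(y) + s`): differentiate along the orbit,
whose velocity is `X` (chain rule). [cite: Anderson2000, §0, (0.1)] -/
theorem IsStationaryKilling.mvfderiv_timeFunction_apply_self (_h : g.IsStationaryKilling τ X univ)
    (hθX : ∀ p, IsMIntegralCurve (fun t ↦ θ (t, p)) X) (hθ0 : ∀ p, θ (0, p) = p)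
    (ht : ContMDiff 𝓘(ℝ, E) 𝓘(ℝ, ℝ) ∞ t) (htθ : ∀ s y, t (θ (s, y)) = t y + s) (y : M) :
    mvfderiv 𝓘(ℝ, E) t y (X y) = 1 := by
  -- chain rule along the orbit through `y`
  have hγ := hθX y 0
  have htd : MDifferentiableAt 𝓘(ℝ, E) 𝓘(ℝ, ℝ) t (θ (0, y)) :=
    (ht _).mdifferentiableAt (by simp)
  have hcomp := htd.hasMFDerivAt.comp 0 hγ
  have hfun : (t ∘ fun s ↦ θ (s, y)) = fun s ↦ t y + s := funext fun s ↦ htθ s y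
  rw [hfun] at hcomp
  -- the derivative of `s ↦ t y + s` is the identity
  have hlin : HasMFDerivAt 𝓘(ℝ, ℝ) 𝓘(ℝ, ℝ) (fun s : ℝ ↦ t y + s) 0
      (ContinuousLinearMap.id ℝ ℝ) := by
    rw [hasMFDerivAt_iff_hasFDerivAt]
    exact ((hasFDerivAt_id (0 : ℝ)).const_add (t y))
  have heq := hcomp.mfderiv.symm.trans hlin.mfderiv
  have h1 := congrArg (fun L ↦ L (1 : ℝ)) heq
  have h2 : mfderiv 𝓘(ℝ, E) 𝓘(ℝ, ℝ) t (θ (0, y)) ((1 : ℝ) • X (θ (0, y))) = (1 : ℝ) := h1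
  rw [one_smul, hθ0] at h2
  exact h2

omit [FiniteDimensional ℝ E] [CompleteSpace E] in
/-- **`dt` is flow invariant**: `dt_{θₛ y}(dθₛ v) = dt_y(v)` — `t ∘ θₛ = t + s` has the same
differential as `t` (chain rule). [cite: Anderson2000, §0, (0.1)] -/
theorem IsStationaryKilling.mvfderiv_timeFunction_flow (_h : g.IsStationaryKilling τ X univ)
    (hθ : ContMDiff (𝓘(ℝ, ℝ).prod 𝓘(ℝ, E)) 𝓘(ℝ, E) 2 θ)
    (ht : ContMDiff 𝓘(ℝ, E) 𝓘(ℝ, ℝ) ∞ t) (htθ : ∀ s y, t (θ (s, y)) = t y + s) (s : ℝ) (y : M)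
    (v : TangentSpace 𝓘(ℝ, E) y) :
    mvfderiv 𝓘(ℝ, E) t (θ (s, y)) (mfderiv 𝓘(ℝ, E) 𝓘(ℝ, E) (fun q ↦ θ (s, q)) y v) =
      mvfderiv 𝓘(ℝ, E) t y v := by
  have hθs : ContMDiff 𝓘(ℝ, E) 𝓘(ℝ, E) 2 (fun q : M ↦ θ (s, q)) :=
    hθ.comp (contMDiff_const.prodMk contMDiff_id)
  have htd : MDifferentiableAt 𝓘(ℝ, E) 𝓘(ℝ, ℝ) t (θ (s, y)) := (ht _).mdifferentiableAt (by simp)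
  have hθd : MDifferentiableAt 𝓘(ℝ, E) 𝓘(ℝ, E) (fun q : M ↦ θ (s, q)) y :=
    hθs.contMDiffAt.mdifferentiableAt two_ne_zero
  have hcomp := mfderiv_comp y htd hθd
  have hfun : (t ∘ fun q : M ↦ θ (s, q)) = fun q ↦ t q + s := funext fun q ↦ htθ s q
  rw [hfun] at hcomp
  -- `d(t + s) = dt`: `q ↦ t q + s` is `t` followed by the translation `r ↦ r + s` of `ℝ`
  have hadd : mfderiv 𝓘(ℝ, E) 𝓘(ℝ, ℝ) (fun q ↦ t q + s) y = mfderiv 𝓘(ℝ, E) 𝓘(ℝ, ℝ) t y := by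
    have htd' : MDifferentiableAt 𝓘(ℝ, E) 𝓘(ℝ, ℝ) t y := (ht _).mdifferentiableAt (by simp)
    have htr : HasMFDerivAt 𝓘(ℝ, ℝ) 𝓘(ℝ, ℝ) (fun r : ℝ ↦ r + s) (t y)
        (ContinuousLinearMap.id ℝ ℝ) :=
      hasMFDerivAt_iff_hasFDerivAt.2 ((hasFDerivAt_id (t y)).add_const s)
    have hc := (htr.comp y htd'.hasMFDerivAt).mfderiv
    exact hc.trans (ContinuousLinearMap.ext fun w ↦ rfl)
  rw [hadd] at hcomp
  have h1 := congrArg (fun L ↦ L v) hcomp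
  change mfderiv 𝓘(ℝ, E) 𝓘(ℝ, ℝ) t (θ (s, y)) (mfderiv 𝓘(ℝ, E) 𝓘(ℝ, E) (fun q ↦ θ (s, q)) y v) =
    mfderiv 𝓘(ℝ, E) 𝓘(ℝ, ℝ) t y v
  exact h1.symm

/-- **The 1-form `ϑ = A − dt`** of a time function: the difference of the metric connection form
and `dt` (Anderson's `θ` in `g_M = -u²(dt + θ)² + π^* g_S`, pulled back to `M`).
[cite: Anderson2000, §0, (0.1)] -/
def IsStationaryKilling.thetaForm (h : g.IsStationaryKilling τ X univ) (t : M → ℝ) (y : M) :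
    TangentSpace 𝓘(ℝ, E) y →L[ℝ] ℝ :=
  h.connForm y - mvfderiv 𝓘(ℝ, E) t y

omit [FiniteDimensional ℝ E] [CompleteSpace E] in
/-- **`ϑ(X) = 0`**: the form `ϑ` is horizontal. [cite: Anderson2000, §0, (0.1)] -/
theorem IsStationaryKilling.thetaForm_apply_self (h : g.IsStationaryKilling τ X univ)
    (hθX : ∀ p, IsMIntegralCurve (fun t ↦ θ (t, p)) X) (hθ0 : ∀ p, θ (0, p) = p)
    (ht : ContMDiff 𝓘(ℝ, E) 𝓘(ℝ, ℝ) ∞ t) (htθ : ∀ s y, t (θ (s, y)) = t y + s) (y : M) :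
    h.thetaForm t y (X y) = 0 := by
  rw [IsStationaryKilling.thetaForm, sub_apply, h.connForm_apply_self,
    h.mvfderiv_timeFunction_apply_self hθX hθ0 ht htθ y, sub_self]

/-- **`ϑ` is flow invariant**: `ϑ_{θₛ y}(dθₛ v) = ϑ_y(v)`. Together with `ϑ(X) = 0`, `ϑ` is the
pull-back of a 1-form on the orbit space `S`. [cite: Anderson2000, §0, (0.1)] -/
theorem IsStationaryKilling.thetaForm_flow (h : g.IsStationaryKilling τ X univ)
    (hθ : ContMDiff (𝓘(ℝ, ℝ).prod 𝓘(ℝ, E)) 𝓘(ℝ, E) 2 θ) (hθ0 : ∀ p, θ (0, p) = p)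
    (hθadd : ∀ t s p, θ (t, θ (s, p)) = θ (t + s, p))
    (hθX : ∀ p, IsMIntegralCurve (fun t ↦ θ (t, p)) X) (ht : ContMDiff 𝓘(ℝ, E) 𝓘(ℝ, ℝ) ∞ t)
    (htθ : ∀ s y, t (θ (s, y)) = t y + s) (s : ℝ) (y : M) (v : TangentSpace 𝓘(ℝ, E) y) :
    h.thetaForm t (θ (s, y)) (mfderiv 𝓘(ℝ, E) 𝓘(ℝ, E) (fun q ↦ θ (s, q)) y v) =
      h.thetaForm t y v := by
  rw [IsStationaryKilling.thetaForm, IsStationaryKilling.thetaForm, sub_apply, sub_apply,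
    h.connForm_flow hθ hθ0 hθadd hθX s y v, h.mvfderiv_timeFunction_flow hθ ht htθ s y v]

omit [FiniteDimensional ℝ E] [CompleteSpace E] in
/-- **Anderson 2000, (0.1)–(0.2): `g_M = -u² (dt + ϑ)² + π^* g_S`, pointwise.** For a stationary
Killing field `X` timelike everywhere and a time function `t`, at every event and for all tangent
vectors `v, w`:
`g(v, w) = -u² (dt(v) + ϑ(v)) (dt(w) + ϑ(w)) + h(v, w)`, where `u² = -⟨X, X⟩`, `ϑ = A − dt` and
`h` is Geroch's orbit form, `= π^* g_S` (`quotientMetricVal_mfderiv_orbitProj`).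
[cite: Anderson2000, §0, (0.1)–(0.2)] -/
theorem IsStationaryKilling.val_eq_anderson (h : g.IsStationaryKilling τ X univ) (t : M → ℝ)
    (y : M) (v w : TangentSpace 𝓘(ℝ, E) y) :
    g.val y v w = -(-g.val y (X y) (X y)) *
        (mvfderiv 𝓘(ℝ, E) t y v + h.thetaForm t y v) *
        (mvfderiv 𝓘(ℝ, E) t y w + h.thetaForm t y w) +
      g.toPseudoRiemannianMetric.orbitBilin X y v w := by
  have hA : ∀ z, mvfderiv 𝓘(ℝ, E) t y z + h.thetaForm t y z = h.connForm y z := fun z ↦ by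
    rw [IsStationaryKilling.thetaForm, sub_apply]; ring
  rw [hA, hA, neg_neg]
  exact h.val_eq_connForm_orbitBilin y v w

end Decomposition

end LorentzianMetric

/-! ### The bundled form -/

namespace Spacetime

universe u

variable {𝓢 : Spacetime.{u} 4} [𝓢.metric.HasLeviCivita]
  {X : Π x : 𝓢.carrier, TangentSpace (𝓡 4) x}

/-- **Anderson 2000, §0, (0.1)–(0.2), for a bundled spacetime.** For a stationary Killing field
`X` of a four-dimensional spacetime (timelike everywhere, complete) and any `C^∞` time function
`t` of its flow (`t(θₛ y) = t(y) + s`; such `t` exist for chronological spacetimes,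
`Spacetime.IsStationaryKilling.exists_timeFunction`), the 1-form `ϑ = A − dt` satisfies
`ϑ(X) = 0`, is flow invariant, and
`g(v, w) = -u² (dt(v) + ϑ(v)) (dt(w) + ϑ(w)) + h(v, w)` with `u² = -⟨X, X⟩` and `h` Geroch's
orbit form `= π^* g_S`. [cite: Anderson2000, §0, (0.1)–(0.2)] -/
theorem IsStationaryKilling.metric_decomposition (hX : 𝓢.IsStationaryKilling X univ)
    {t : 𝓢.carrier → ℝ} (ht : ContMDiff (𝓡 4) 𝓘(ℝ, ℝ) ∞ t)
    (htθ : ∀ s y, t (hX.flow (s, y)) = t y + s) :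
    (∀ y, hX.thetaForm t y (X y) = 0) ∧
    (∀ (s : ℝ) (y : 𝓢.carrier) (v : TangentSpace (𝓡 4) y),
      hX.thetaForm t (hX.flow (s, y)) (mfderiv (𝓡 4) (𝓡 4) (fun q ↦ hX.flow (s, q)) y v) =
        hX.thetaForm t y v) ∧
    ∀ (y : 𝓢.carrier) (v w : TangentSpace (𝓡 4) y),
      𝓢.metric.val y v w = -(-𝓢.metric.val y (X y) (X y)) *
          (mvfderiv (𝓡 4) t y v + hX.thetaForm t y v) *
          (mvfderiv (𝓡 4) t y w + hX.thetaForm t y w) +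
        𝓢.metric.toPseudoRiemannianMetric.orbitBilin X y v w :=
  ⟨fun y ↦ hX.thetaForm_apply_self hX.isMIntegralCurve_flow hX.flow_zero ht htθ y,
    fun s y v ↦ hX.thetaForm_flow (hX.contMDiff_flow.of_le (WithTop.coe_le_coe.mpr le_top))
      hX.flow_zero hX.flow_add hX.isMIntegralCurve_flow ht htθ s y v,
    fun y v w ↦ hX.val_eq_anderson t y v w⟩

end Spacetime

end Literature.Geometry.Lorentzian

end
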